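import Literature.MathematicalPhysics.QuantumLattice.LiebWuMomentumMonotone
import HarnessLib

/-!
# Lieb–Wu 2003, Lemma 2 (Monotonicity in `B`): `G_S = K ∗ (1_S σ_S)` grows with the range

Family `hubbard`. Lieb–Wu, Physica A 321 (2003) 1, §5, Lemma 2: "When `B` increases with `Q` fixed, `f(x)`
increases pointwise for all `x ∈ ℝ`." In the tree's variables `f - t = G_S := K ∗ (1_S σ_S)`
(`liebWuG U Q S`; `ρ_S(k) = 1/2π + cos k · G_S(sin k)`). The printed proof writes (fiterate1)
`f = (1 + ÛD̂)t + ÛÂf`, i.e. `G = Û(Â + D̂)t + ÛÂG`, with `Û` pointwise increasing in `B`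
(`LiebWuMomentumMonotone`: `Ûg = Φ_S(R̂g)`, `liebWuPhi_mono_set`). This file proves

* `liebWuG_eq_phi`: **(fiterate1)** `G_S = Φ_S ξ + Φ_S(R̂ÂG_S)` (`ξ = R̂(Â + D̂)t`, `R̂Â G = liebWuRA Q U G`), from
  `σ_S = V_S(ξ + R̂ÂK̂B̂σ_S)` — the Neumann solution of (S) is the resolvent applied to its own source (uniqueness
  of the resolvent fixed point, `eq_liebWuResolvent_of_fixedPoint`);
* **`liebWuG_mono_set` (Lemma 2):** `S ⊆ S'` ⇒ `G_S ≤ G_{S'}` pointwise on `ℝ`. Instead of summing the printed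
  series `[1 + ÛÂ + (ÛÂ)² + ⋯]` (fiterate2) we use positivity directly: with `P = (G_S - G_{S'})⁺`, (fiterate1),
  the monotonicity of `Û` in `B` and in its argument give `G_S ≤ G_{S'} + Φ_S(R̂ÂP)`, so
  `P ≤ Φ_S(R̂ÂP) ≤ K̂R̂ÂP = u ∗ (ÂP) ≤ u ∗ P`; since `∫u = ½ < 1`, `P = 0` (sub-convolution vanishing).

The consequences "`ρ(k)` increases for `|k| ≤ π/2` and decreases for `π/2 ≤ |k| ≤ π`" and Theorem 2's
monotonicity of `N/N_a`, `M/N` follow in `LiebWuMagnetizationMonotone`. No named fact.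

## References

* E. H. Lieb, F. Y. Wu, Physica A 321 (2003) 1–27 = arXiv:cond-mat/0207529, §5, Lemma 2, eqs. (feqn),
  (U), (keyequation), (fiterate1), (fiterate2) (key `LiebWuPhysicaA2003`).
-/

noncomputable section

open MeasureTheory Set Real Filter intervalIntegral
open Literature.Analysis.SpecialFunctions Literature.MeasureTheory.Lebesgue
open scoped Convolution Topology

namespace Literature.MathematicalPhysics.QuantumLattice

namespace LiebWuLemma2G

variable {f g k : ℝ → ℝ} {B B' : ℝ}

/-- `t ↦ f(t) g(x - t)` is integrable for `f ∈ L¹`, `g` bounded continuous. [folklore] -/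
private theorem integrable_mul_sub₉ (hf : Integrable f) (hgc : Continuous g) (hgB : ∀ y, |g y| ≤ B)
    (x : ℝ) : Integrable fun t => f t * g (x - t) :=
  hf.mul_bdd (hgc.comp (continuous_const.sub continuous_id)).aestronglyMeasurable
    (Eventually.of_forall fun t => by rw [Real.norm_eq_abs]; exact hgB _)

/-- `x ↦ ∫ f(t) g(x - t) dt` is continuous for `f ∈ L¹`, `g` bounded continuous. [folklore] -/
private theorem continuous_conv₉ (hf : Integrable f) (hgc : Continuous g) (hgB : ∀ y, |g y| ≤ B) :
    Continuous fun x => ∫ t, f t * g (x - t) := by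
  have h : (fun x => ∫ t, f t * g (x - t)) = f ⋆[ContinuousLinearMap.mul ℝ ℝ, volume] g := by
    funext x; rw [convolution_def]; simp only [ContinuousLinearMap.mul_apply']
  rw [h]
  refine BddAbove.continuous_convolution_right_of_integrable (L := ContinuousLinearMap.mul ℝ ℝ)
    ⟨B, ?_⟩ hf hgc
  rintro _ ⟨y, rfl⟩
  exact (Real.norm_eq_abs _).trans_le (hgB y)

/-- The convolution of integrable functions is integrable. [folklore] -/
private theorem integrable_conv₉ (hf : Integrable f) (hg : Integrable g) :
    Integrable (fun x => ∫ t, f t * g (x - t)) := by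
  have h : (fun x => ∫ t, f t * g (x - t)) = f ⋆[ContinuousLinearMap.mul ℝ ℝ, volume] g := by
    funext x; rw [convolution_def]; simp only [ContinuousLinearMap.mul_apply']
  rw [h]
  exact hf.integrable_convolution _ hg

/-- `0 ≤ ∫ f(t) g(x - t) dt ≤ B ∫ f` for `f, g ≥ 0`, `g ≤ B`. [folklore] -/
private theorem conv_nonneg_le₉ (hf : Integrable f) (hf0 : ∀ t, 0 ≤ f t) (hg0 : ∀ y, 0 ≤ g y)
    (hgB : ∀ y, g y ≤ B) (x : ℝ) : 0 ≤ ∫ t, f t * g (x - t) ∧ ∫ t, f t * g (x - t) ≤ B * ∫ t, f t := by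
  refine ⟨integral_nonneg fun t => mul_nonneg (hf0 t) (hg0 _), ?_⟩
  rw [← MeasureTheory.integral_const_mul]
  refine integral_mono_of_nonneg (Eventually.of_forall fun t => mul_nonneg (hf0 t) (hg0 _))
    (hf.const_mul B) (Eventually.of_forall fun t => ?_)
  dsimp only
  rw [mul_comm B]
  exact mul_le_mul_of_nonneg_left (hgB _) (hf0 t)

/-- Associativity `((f ∗ g) ∗ k)(x) = (f ∗ (g ∗ k))(x)`. [folklore] -/
private theorem conv_conv₉ (hf : Integrable f) (hgi : Integrable g) (hkc : Continuous k)
    (hkB : ∀ y, |k y| ≤ B') (x : ℝ) :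
    ∫ y, (∫ z, f z * g (y - z)) * k (x - y) = ∫ z, f z * ∫ s, g s * k (x - z - s) := by
  have hprod : Integrable (fun p : ℝ × ℝ => f p.2 * g (p.1 - p.2)) ((volume : Measure ℝ).prod volume) :=
    hf.convolution_integrand (ContinuousLinearMap.mul ℝ ℝ) hgi
  have hkm : Continuous fun p : ℝ × ℝ => k (x - p.1) := hkc.comp (continuous_const.sub continuous_fst)
  have hF : Integrable (Function.uncurry fun y z => f z * g (y - z) * k (x - y)) ((volume : Measure ℝ).prod volume) :=
    hprod.mul_bdd (c := B') hkm.aestronglyMeasurable (Eventually.of_forall fun p => by rw [Real.norm_eq_abs]; exact hkB _)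
  calc ∫ y, (∫ z, f z * g (y - z)) * k (x - y) = ∫ y, ∫ z, f z * g (y - z) * k (x - y) := by
        refine MeasureTheory.integral_congr_ae (Eventually.of_forall fun y => ?_)
        exact (MeasureTheory.integral_mul_const (k (x - y)) _).symm
    _ = ∫ z, ∫ y, f z * g (y - z) * k (x - y) := integral_integral_swap hF
    _ = ∫ z, f z * ∫ s, g s * k (x - z - s) := by
        refine MeasureTheory.integral_congr_ae (Eventually.of_forall fun z => ?_)
        dsimp only
        rw [← MeasureTheory.integral_const_mul, ← integral_add_right_eq_self (fun y => f z * g (y - z) * k (x - y)) z]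
        refine MeasureTheory.integral_congr_ae (Eventually.of_forall fun s => ?_)
        dsimp only
        rw [add_sub_cancel_right, show x - (s + z) = x - z - s by ring]
        ring

end LiebWuLemma2G

open LiebWuLemma2G

/-- The operator **`R̂Â`** on a function `G` of the `x`-variable: `(R̂ÂG)(x) = ½ ∫ 1_{(-a,a]}(y) G(y) r(x - y) dy`,
`a = sin Q` (so that `liebWuW U Q h = R̂Â(K ∗ h)`). [cite: LiebWuPhysicaA2003, §5, eq. (W)] -/
def liebWuRA (Q U : ℝ) (G : ℝ → ℝ) (x : ℝ) : ℝ :=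
  1 / 2 * ∫ y, ((Ioc (-Real.sin Q) (Real.sin Q)).indicator (fun _ => (1 : ℝ)) y * G y) * sechKernel (U / 4) (x - y)

variable {U Q : ℝ} {S S' : Set ℝ} {G G₁ G₂ : ℝ → ℝ} {M M₁ M₂ : ℝ}

section RA

/-- Properties of `R̂Â` on nonnegative integrable `G`: continuous, `0 ≤ R̂ÂG ≤ (1/(4c))∫G`, integrable.
[cite: LiebWuPhysicaA2003, §5, eq. (W)] -/
theorem liebWuRA_props (hU : 0 < U) (hG0 : ∀ x, 0 ≤ G x) (hGi : Integrable G) :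
    Continuous (liebWuRA Q U G) ∧ (∀ x, 0 ≤ liebWuRA Q U G x) ∧ Integrable (liebWuRA Q U G) ∧
      ∀ x, liebWuRA Q U G x ≤ 1 / (4 * (U / 4)) * ∫ t, G t := by
  have hc : 0 < U / 4 := by positivity
  set A : ℝ → ℝ := (Ioc (-Real.sin Q) (Real.sin Q)).indicator (fun _ => (1 : ℝ)) with hA
  have hA01 : ∀ y, 0 ≤ A y ∧ A y ≤ 1 := fun y => by
    by_cases hy : y ∈ Ioc (-Real.sin Q) (Real.sin Q)
    · simp [hA, indicator_of_mem hy]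
    · simp [hA, indicator_of_notMem hy]
  have hAm : AEStronglyMeasurable A volume := aestronglyMeasurable_const.indicator measurableSet_Ioc
  have hF0 : ∀ y, 0 ≤ A y * G y := fun y => mul_nonneg (hA01 y).1 (hG0 y)
  have hFle : ∀ y, A y * G y ≤ G y := fun y => by nlinarith [(hA01 y).2, hG0 y, (hA01 y).1]
  have hFi : Integrable fun y => A y * G y :=
    hGi.bdd_mul hAm (c := 1) (Eventually.of_forall fun y => by
      rw [Real.norm_eq_abs, abs_of_nonneg (hA01 y).1]; exact (hA01 y).2)
  have hFint : ∫ y, A y * G y ≤ ∫ t, G t := integral_mono hFi hGi hFle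
  have hrB : ∀ y, |sechKernel (U / 4) y| ≤ 1 / (2 * (U / 4)) := fun y => by
    rw [abs_of_pos (sechKernel_pos hc y)]; exact sechKernel_le hc y
  have hconv := fun x => conv_nonneg_le₉ hFi hF0 (fun z => (sechKernel_pos hc z).le) (sechKernel_le hc) x
  refine ⟨continuous_const.mul (continuous_conv₉ hFi (continuous_sechKernel hc) hrB),
    fun x => mul_nonneg (by norm_num) (hconv x).1,
    (integrable_conv₉ hFi (integrable_sechKernel hc)).const_mul _, fun x => ?_⟩
  rw [liebWuRA]
  calc 1 / 2 * ∫ y, A y * G y * sechKernel (U / 4) (x - y) ≤ 1 / 2 * (1 / (2 * (U / 4)) * ∫ y, A y * G y) :=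
        mul_le_mul_of_nonneg_left (hconv x).2 (by norm_num)
    _ ≤ 1 / 2 * (1 / (2 * (U / 4)) * ∫ t, G t) :=
        mul_le_mul_of_nonneg_left (mul_le_mul_of_nonneg_left hFint (by positivity)) (by norm_num)
    _ = _ := by ring

/-- `R̂Â` is additive and monotone. [cite: LiebWuPhysicaA2003, §5, eq. (W)] -/
theorem liebWuRA_add_mono (hU : 0 < U) (h₁i : Integrable G₁) (h₂i : Integrable G₂) (x : ℝ) :
    liebWuRA Q U (fun t => G₁ t + G₂ t) x = liebWuRA Q U G₁ x + liebWuRA Q U G₂ x ∧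
      ((∀ t, G₁ t ≤ G₂ t) → liebWuRA Q U G₁ x ≤ liebWuRA Q U G₂ x) := by
  have hc : 0 < U / 4 := by positivity
  set A : ℝ → ℝ := (Ioc (-Real.sin Q) (Real.sin Q)).indicator (fun _ => (1 : ℝ)) with hA
  have hA01 : ∀ y, 0 ≤ A y ∧ A y ≤ 1 := fun y => by
    by_cases hy : y ∈ Ioc (-Real.sin Q) (Real.sin Q)
    · simp [hA, indicator_of_mem hy]
    · simp [hA, indicator_of_notMem hy]
  have hAm : AEStronglyMeasurable A volume := aestronglyMeasurable_const.indicator measurableSet_Ioc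
  have hFi : ∀ {G : ℝ → ℝ}, Integrable G → Integrable fun y => A y * G y := fun hGi =>
    hGi.bdd_mul hAm (c := 1) (Eventually.of_forall fun y => by
      rw [Real.norm_eq_abs, abs_of_nonneg (hA01 y).1]; exact (hA01 y).2)
  have hrB : ∀ y, |sechKernel (U / 4) y| ≤ 1 / (2 * (U / 4)) := fun y => by
    rw [abs_of_pos (sechKernel_pos hc y)]; exact sechKernel_le hc y
  have hi1 := integrable_mul_sub₉ (hFi h₁i) (continuous_sechKernel hc) hrB x
  have hi2 := integrable_mul_sub₉ (hFi h₂i) (continuous_sechKernel hc) hrB x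
  refine ⟨?_, fun hle => ?_⟩
  · rw [liebWuRA, liebWuRA, liebWuRA, ← mul_add, ← integral_add hi1 hi2]
    congr 1
    refine MeasureTheory.integral_congr_ae (Eventually.of_forall fun y => ?_)
    ring
  · rw [liebWuRA, liebWuRA]
    refine mul_le_mul_of_nonneg_left (integral_mono hi1 hi2 fun y => ?_) (by norm_num)
    exact mul_le_mul_of_nonneg_right (mul_le_mul_of_nonneg_left (hle y) (hA01 y).1) (sechKernel_pos hc _).le

/-- **`K̂R̂Â = ÛÂ`:** `∫ (R̂ÂP)(t) K(x - t) dt = ∫ 1_{(-a,a]}(y) P(y) u(x - y) dy` (`r ∗ K = 2u`).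
[cite: LiebWuPhysicaA2003, §5, eq. (U)] -/
theorem integral_liebWuRA_mul_cauchyDensity (hU : 0 < U) {P : ℝ → ℝ} (hPi : Integrable P) (x : ℝ) :
    ∫ t, liebWuRA Q U P t * cauchyDensity (U / 4) (x - t) =
      ∫ y, ((Ioc (-Real.sin Q) (Real.sin Q)).indicator (fun _ => (1 : ℝ)) y * P y) * fermiKernel (U / 4) (x - y) := by
  have hc : 0 < U / 4 := by positivity
  have hKB : ∀ y, |cauchyDensity (U / 4) y| ≤ 1 / (π * (U / 4)) := fun y => by
    rw [abs_of_pos (cauchyDensity_pos hc y)]; exact cauchyDensity_le hc y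
  have hAm : AEStronglyMeasurable ((Ioc (-Real.sin Q) (Real.sin Q)).indicator (fun _ => (1 : ℝ))) volume :=
    aestronglyMeasurable_const.indicator measurableSet_Ioc
  have hFi : Integrable fun y => (Ioc (-Real.sin Q) (Real.sin Q)).indicator (fun _ => (1 : ℝ)) y * P y :=
    hPi.bdd_mul hAm (c := 1) (Eventually.of_forall fun y => by
      rw [Real.norm_eq_abs]
      by_cases hy : y ∈ Ioc (-Real.sin Q) (Real.sin Q)
      · rw [indicator_of_mem hy, abs_one]
      · rw [indicator_of_notMem hy, abs_zero]; exact zero_le_one)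
  have h1 : (fun t => liebWuRA Q U P t * cauchyDensity (U / 4) (x - t)) = fun t => 1 / 2 *
      ((∫ y, ((Ioc (-Real.sin Q) (Real.sin Q)).indicator (fun _ => (1 : ℝ)) y * P y) * sechKernel (U / 4) (t - y)) *
        cauchyDensity (U / 4) (x - t)) := by
    funext t; rw [liebWuRA]; ring
  rw [h1, MeasureTheory.integral_const_mul, conv_conv₉ hFi (integrable_sechKernel hc) (continuous_cauchyDensity hc) hKB,
    ← MeasureTheory.integral_const_mul]
  refine MeasureTheory.integral_congr_ae (Eventually.of_forall fun y => ?_)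
  dsimp only
  rw [integral_sechKernel_mul_cauchyDensity hc (x - y)]
  ring

end RA

section Lemma2

/-- Properties of `G_S = K ∗ (1_S σ_S)`: continuous, `0 ≤ G_S ≤ (1/(πc)) ∫σ_S`, integrable.
[cite: LiebWuPhysicaA2003, §5, eq. (feqn)] -/
theorem liebWuG_props (hU : 0 < U) (hQ : 0 < Q) (hS : MeasurableSet S) :
    Continuous (liebWuG U Q S) ∧ (∀ x, 0 ≤ liebWuG U Q S x) ∧ Integrable (liebWuG U Q S) ∧
      ∀ x, liebWuG U Q S x ≤ 1 / (π * (U / 4)) * ∫ t, liebWuSigmaAtS U Q S t := by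
  have hc : 0 < U / 4 := by positivity
  have hKB : ∀ y, |cauchyDensity (U / 4) y| ≤ 1 / (π * (U / 4)) := fun y => by
    rw [abs_of_pos (cauchyDensity_pos hc y)]; exact cauchyDensity_le hc y
  have hσi := integrable_liebWuSigmaAtS hU hQ hS
  have hσ0 : ∀ t, 0 ≤ S.indicator (liebWuSigmaAtS U Q S) t := fun t =>
    indicator_nonneg (fun s _ => (liebWuSigmaAtS_pos hU hQ hS s).le) _
  have hσSi : Integrable (S.indicator (liebWuSigmaAtS U Q S)) := hσi.indicator hS
  have hle : ∫ t, S.indicator (liebWuSigmaAtS U Q S) t ≤ ∫ t, liebWuSigmaAtS U Q S t :=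
    integral_mono hσSi hσi fun t => indicator_le_self' (fun s _ => (liebWuSigmaAtS_pos hU hQ hS s).le) t
  have h := fun x => conv_nonneg_le₉ hσSi hσ0 (fun y => (cauchyDensity_pos hc y).le) (cauchyDensity_le hc) x
  exact ⟨continuous_conv₉ hσSi (continuous_cauchyDensity hc) hKB, fun x => (h x).1,
    integrable_conv₉ hσSi (integrable_cauchyDensity hc.le),
    fun x => (h x).2.trans (mul_le_mul_of_nonneg_left hle (by positivity))⟩

/-- **`σ_S = V_S(ξ + R̂ÂG_S)`**: the Neumann solution of eq. (S) is the resolvent `(1 + K̂²B̂)⁻¹` applied to its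
own source `R̂(Â + D̂)t + R̂ÂK̂B̂σ_S` (uniqueness of the resolvent fixed point).
[cite: LiebWuPhysicaA2003, §5, eqs. (S), (general)] -/
theorem liebWuSigmaAtS_eq_resolvent (hU : 0 < U) (hQ : 0 < Q) (hS : MeasurableSet S) :
    liebWuSigmaAtS U Q S = liebWuResolvent U S (fun x => liebWuXi U Q x + liebWuRA Q U (liebWuG U Q S) x) := by
  obtain ⟨-, hG0, hGi, -⟩ := liebWuG_props hU hQ hS
  obtain ⟨hRc, hR0, hRi, hRM⟩ := liebWuRA_props (Q := Q) hU hG0 hGi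
  refine eq_liebWuResolvent_of_fixedPoint hU hS ((continuous_liebWuXi hU Q).add hRc)
    (fun x => add_nonneg (liebWuXi_pos hU hQ x).le (hR0 x)) ((integrable_liebWuXi_and_integral hU hQ).1.add hRi)
    (M := 1 / (4 * π) * ((1 / (2 * (U / 4))) * (Q - -Q)) + 1 / (4 * (U / 4)) * ∫ t, liebWuG U Q S t)
    (fun x => add_le_add (liebWuXi_le hU hQ x) (hRM x)) (continuous_liebWuSigmaAtS hU hQ hS)
    (integrable_liebWuSigmaAtS hU hQ hS) fun x => ?_
  rw [liebWuSigmaAtS_eq_xi_add_WS hU hQ hS x]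
  simp only [Pi.add_apply, liebWuWS, liebWuW, liebWuRA, liebWuG, liebWuT]
  ring

/-- **(fiterate1): `G_S = Φ_S ξ + Φ_S(R̂ÂG_S)`** (`f = t + Û(Â + D̂)t + ÛÂf`).
[cite: LiebWuPhysicaA2003, §5, eq. (fiterate1)] -/
theorem liebWuG_eq_phi (hU : 0 < U) (hQ : 0 < Q) (hS : MeasurableSet S) (x : ℝ) :
    liebWuG U Q S x = liebWuPhi U S (liebWuXi U Q) x + liebWuPhi U S (liebWuRA Q U (liebWuG U Q S)) x := by
  obtain ⟨-, hG0, hGi, -⟩ := liebWuG_props hU hQ hS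
  obtain ⟨hRc, hR0, hRi, hRM⟩ := liebWuRA_props (Q := Q) hU hG0 hGi
  rw [← liebWuPhi_add hU hS (continuous_liebWuXi hU Q) (fun x => (liebWuXi_pos hU hQ x).le)
    (integrable_liebWuXi_and_integral hU hQ).1 (liebWuXi_le hU hQ) hRc hR0 hRi hRM, liebWuPhi,
    ← liebWuSigmaAtS_eq_resolvent hU hQ hS, liebWuG]

/-- **Lieb–Wu 2003, Lemma 2 (Monotonicity in `B`):** for measurable ranges `S ⊆ S'`,
`G_S ≤ G_{S'}` pointwise on `ℝ` ("`f(x)` increases pointwise for all `x ∈ ℝ`").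
[cite: LiebWuPhysicaA2003, §5, Lemma 2] -/
theorem liebWuG_mono_set (hU : 0 < U) (hQ : 0 < Q) (hS : MeasurableSet S) (hS' : MeasurableSet S')
    (hSS' : S ⊆ S') (x : ℝ) : liebWuG U Q S x ≤ liebWuG U Q S' x := by
  have hc : 0 < U / 4 := by positivity
  have huc : Continuous (fermiKernel (U / 4)) := continuous_fermiKernel hc
  have huB : ∀ y, |fermiKernel (U / 4) y| ≤ 1 / (2 * π * (U / 4)) := fun y => by
    rw [abs_of_nonneg (fermiKernel_nonneg hc y)]; exact fermiKernel_le hc y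
  obtain ⟨hGc, hG0, hGi, -⟩ := liebWuG_props hU hQ hS
  obtain ⟨hG'c, hG'0, hG'i, -⟩ := liebWuG_props hU hQ hS'
  -- the positive part `P = (G_S - G_{S'})⁺`
  obtain ⟨P, hP⟩ : ∃ P : ℝ → ℝ, P = fun y => max (liebWuG U Q S y - liebWuG U Q S' y) 0 := ⟨_, rfl⟩
  have hPdef : ∀ y, P y = max (liebWuG U Q S y - liebWuG U Q S' y) 0 := fun y => by rw [hP]
  have hPc : Continuous P := by rw [hP]; exact (hGc.sub hG'c).max continuous_const
  have hPi : Integrable P := by rw [hP]; exact (hGi.sub hG'i).pos_part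
  have hP0 : ∀ y, 0 ≤ P y := fun y => by rw [hPdef]; exact le_max_right _ _
  have hGle : ∀ y, liebWuG U Q S y ≤ liebWuG U Q S' y + P y := fun y => by
    have := le_max_left (liebWuG U Q S y - liebWuG U Q S' y) 0
    rw [hPdef]; linarith
  -- the sources `ξ`, `R̂ÂG_S`, `R̂ÂG_{S'}`, `R̂ÂP`
  have hξc := continuous_liebWuXi hU Q
  have hξ0 : ∀ y, 0 ≤ liebWuXi U Q y := fun y => (liebWuXi_pos hU hQ y).le
  have hξi := (integrable_liebWuXi_and_integral hU hQ).1
  have hξM := liebWuXi_le hU hQ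
  obtain ⟨hRc, hR0, hRi, hRM⟩ := liebWuRA_props (Q := Q) hU hG0 hGi
  obtain ⟨hR'c, hR'0, hR'i, hR'M⟩ := liebWuRA_props (Q := Q) hU hG'0 hG'i
  obtain ⟨hRPc, hRP0, hRPi, hRPM⟩ := liebWuRA_props (Q := Q) hU hP0 hPi
  obtain ⟨-, hΦ0, hΦle, -⟩ := liebWuPhi_props hU hS hRPc hRP0 hRPi hRPM
  have hRAle : ∀ t, liebWuRA Q U (liebWuG U Q S) t ≤ liebWuRA Q U (liebWuG U Q S') t + liebWuRA Q U P t := by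
    intro t
    rw [← (liebWuRA_add_mono (Q := Q) hU hG'i hPi t).1]
    exact (liebWuRA_add_mono (Q := Q) hU hGi (hG'i.add hPi) t).2 hGle
  -- (fiterate1) for both ranges: `G_S - G_{S'} ≤ Φ_S(R̂ÂP)`
  have hdiff : ∀ y, liebWuG U Q S y - liebWuG U Q S' y ≤ liebWuPhi U S (liebWuRA Q U P) y := by
    intro y
    have h1 : liebWuPhi U S (liebWuXi U Q) y ≤ liebWuPhi U S' (liebWuXi U Q) y :=
      liebWuPhi_mono_set hU hS hS' hSS' hξc hξ0 hξi hξM y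
    have h2 : liebWuPhi U S (liebWuRA Q U (liebWuG U Q S)) y ≤
        liebWuPhi U S (fun t => liebWuRA Q U (liebWuG U Q S') t + liebWuRA Q U P t) y :=
      liebWuPhi_mono hU hS hRc hR0 hRi hRM (hR'c.add hRPc) (fun t => add_nonneg (hR'0 t) (hRP0 t))
        (hR'i.add hRPi) (fun t => add_le_add (hR'M t) (hRPM t)) hRAle y
    have h3 : liebWuPhi U S (fun t => liebWuRA Q U (liebWuG U Q S') t + liebWuRA Q U P t) y =
        liebWuPhi U S (liebWuRA Q U (liebWuG U Q S')) y + liebWuPhi U S (liebWuRA Q U P) y :=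
      liebWuPhi_add hU hS hR'c hR'0 hR'i hR'M hRPc hRP0 hRPi hRPM y
    have h4 : liebWuPhi U S (liebWuRA Q U (liebWuG U Q S')) y ≤ liebWuPhi U S' (liebWuRA Q U (liebWuG U Q S')) y :=
      liebWuPhi_mono_set hU hS hS' hSS' hR'c hR'0 hR'i hR'M y
    have hyS := liebWuG_eq_phi hU hQ hS y
    have hyS' := liebWuG_eq_phi hU hQ hS' y
    linarith
  -- `P ≤ Φ_S(R̂ÂP) ≤ K̂R̂ÂP = u ∗ (ÂP) ≤ u ∗ P`, hence `P = 0` a.e., hence everywhere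
  have hAm : AEStronglyMeasurable ((Ioc (-Real.sin Q) (Real.sin Q)).indicator (fun _ => (1 : ℝ))) volume :=
    aestronglyMeasurable_const.indicator measurableSet_Ioc
  have hAPi : Integrable fun t => (Ioc (-Real.sin Q) (Real.sin Q)).indicator (fun _ => (1 : ℝ)) t * P t :=
    hPi.bdd_mul hAm (c := 1) (Eventually.of_forall fun t => by
      rw [Real.norm_eq_abs]
      by_cases ht : t ∈ Ioc (-Real.sin Q) (Real.sin Q)
      · rw [indicator_of_mem ht, abs_one]
      · rw [indicator_of_notMem ht, abs_zero]; exact zero_le_one)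
  have hdom : ∀ y, P y ≤ ∫ t, fermiKernel (U / 4) (y - t) * P t := by
    intro y
    have hK : liebWuPhi U S (liebWuRA Q U P) y ≤ ∫ t, fermiKernel (U / 4) (y - t) * P t := by
      refine (hΦle y).trans ?_
      rw [integral_liebWuRA_mul_cauchyDensity hU hPi y]
      refine integral_mono (integrable_mul_sub₉ hAPi huc huB y)
        ((integrable_mul_sub₉ hPi huc huB y).congr (Eventually.of_forall fun t => mul_comm _ _)) fun t => ?_
      dsimp only
      rw [mul_comm (fermiKernel (U / 4) (y - t))]
      refine mul_le_mul_of_nonneg_right ?_ (fermiKernel_nonneg hc _)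
      by_cases ht : t ∈ Ioc (-Real.sin Q) (Real.sin Q)
      · rw [indicator_of_mem ht, one_mul]
      · rw [indicator_of_notMem ht, zero_mul]; exact hP0 t
    rw [hPdef]
    exact max_le ((hdiff y).trans hK) ((hΦ0 y).trans hK)
  have hP_ae : P =ᵐ[volume] 0 :=
    ae_eq_zero_of_le_integral_sub huc.measurable hPc.measurable (fermiKernel_nonneg hc) hP0
      (integrable_fermiKernel hc) hPi (by rw [integral_fermiKernel hc]; norm_num) (Eventually.of_forall hdom)
  have hPx : P x = 0 := congrFun ((Continuous.ae_eq_iff_eq volume hPc continuous_const).1 hP_ae) x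
  linarith [hGle x]

end Lemma2

end Literature.MathematicalPhysics.QuantumLattice

end
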